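import Mathlib.LinearAlgebra.Matrix.Charpoly.Coeff
import Mathlib.RingTheory.AdjoinRoot
import Mathlib.Algebra.CharP.Two
import Mathlib.Algebra.CharP.Algebra
import Mathlib.FieldTheory.Finite.Basic
import Mathlib.Tactic
import Summits.BirchSwinnertonDyer.BirchSwinnertonDyer.Theorems.GenusKolyvaginAtTwoFullVertexDefs
import HarnessLib

/-!
# LINE 49 «full_vertex» — the NORM FORM of `det Φ₃(B)` over `𝔽₂` (pen memo #4 Thm 10.1), def-free via the characteristic polynomial

Crux R″ `RankOneTwoTorsionResidualAtTwo` (stmt-BirchSwinnertonDyer-27478) of route GenusKolyvaginAtTwo, LINE 49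
«torsion_cell_full_vertex_bsdidea1» (pen bsd-idea-1).  SUPPORT algebra for the line's SEL law (landed:
`#Sel₂(C₀) = 4·#ker Φ₃(Ĝ)`, `#Sel₂(C₁) = 8·#ker Φ₃(B)`, `…TorsionCellSELIsoClassLawC0/C1`) and its decidable indicator
`LaplacianPairCriterion Q₀ p₀ = [det Φ₃(Ĝ) = 1 ∧ det Φ₃(B) = 1]` (`…FullVertexDefs`): this file hosts the pen's HOME-only brick
`line49/engine/Phi3NormForm.lean` r3 (memo #4 §10 Theorem 10.1) in a DEF-FREE form, the pen's principal-minor sums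
`A_r = Σ_{N − |S| ≡ r (3)} det B_{S,S}` being written as sums of CHARACTERISTIC-POLYNOMIAL COEFFICIENTS
`A_r(B) = Σ_{j ≤ N, j ≡ r (3)} coeff_j χ_B` (the same thing: over `𝔽₂`, `coeff_{N−k} χ_B = Σ_{|s| = k} det B_s`, Mathlib
`Matrix.charpoly_coeff_eq_sum_minors`, restated here as `charpoly_coeff_eq_sum_minors_zmod2`).

For every square matrix `B` over `𝔽₂`:
  `det Φ₃(B) = det(B² + B + 1) = A₀ + A₁ + A₂ + A₀A₁ + A₀A₂ + A₁A₂ = N_{𝔽₄/𝔽₂}(χ_B(ω))`,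
equivalently `det Φ₃(B) = 1 ⟺ A₀, A₁, A₂ are not all equal` (`det_phi3_eq_one_iff`), `= 0 ⟺ A₀ = A₁ = A₂`.

* `eval_eq_sum_mod_three` — for `x³ = 1`: `f(x) = S₀ + S₁x + S₂x²`, `S_r = Σ_{j ≡ r (3)} coeff_j f`;
* `phi3_factor` — `B² + B + 1 = (B + ω)(B + ω²)` in characteristic `2` (`ω² + ω + 1 = 0`);
* `det_add_scalar_eq_eval_charpoly` — `det(B + x) = χ_B(x)` in characteristic `2`;
* `det_phi3_eq_of_root` — over any characteristic-`2` commutative ring with a root `ω` of `X² + X + 1`;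
* **`det_phi3_eq`**, **`det_phi3_eq_one_iff`**, `det_phi3_eq_zero_iff` — over `𝔽₂`, by base change to
  `𝔽₂[X]/(X² + X + 1)` (`AdjoinRoot`) and `a² = a`;
* `charpoly_coeff_eq_sum_minors_zmod2` (the pen's `A_r` = ours), `charpoly_coeff_zero_eq_det` (the top minor `a_N = det B`,
  the «genus bit» of memo #4 Cor 10.3 on the bordered side);
* **`laplacianPairCriterion_iff_coeff_sums`** — LINE 49's criterion read through the coefficient sums of `Ĝ(Q₀)` and
  `B(Q₀, p₀)`: «a cell is Selmer-generic iff neither for `Ĝ` nor for `B` the three sums `A₀, A₁, A₂` coincide».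

Everything is proved (no `sorry`, standard axioms); nothing here is a statement of the line, and NOTHING HERE PROVES R″ or any
summit — BSD is not advanced by this file alone (bookkeeping identity for SEL's indicator).

## References

* [HeathBrown1994SelmerCongruentII] D. R. Heath-Brown, Invent. Math. 118 (1994), §2 (the `𝔽₄`-structure behind `Φ₃`).
* [Kane2013SelmerTwists] D. M. Kane, Algebra Number Theory 7 (2013), §2.
-/

open Matrix Finset Polynomial

namespace Summit.BirchSwinnertonDyer.BirchSwinnertonDyer.Theorems.GenusKolyvaginAtTwo.FullVertex.Phi3Norm

variable {n : Type*} [Fintype n] [DecidableEq n]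

section CharTwo

variable {F : Type*} [CommRing F]

/-- `x³ = 1 ⟹ x^m = x^(m mod 3)`. [cite: HeathBrown1994SelmerCongruentII, §2] -/
theorem pow_eq_pow_mod_three {x : F} (hx : x ^ 3 = 1) (m : ℕ) : x ^ m = x ^ (m % 3) := by
  conv_lhs => rw [← Nat.div_add_mod m 3, pow_add, pow_mul, hx, one_pow, one_mul]

/-- For `x` with `x³ = 1` and a polynomial `f` of degree `< N`: `f(x) = S₀ + S₁ x + S₂ x²`, where
`S_r = Σ_{j < N, j ≡ r (mod 3)} coeff_j f`. [cite: HeathBrown1994SelmerCongruentII, §2] -/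
theorem eval_eq_sum_mod_three (f : F[X]) {N : ℕ} (hN : f.natDegree < N) {x : F} (hx : x ^ 3 = 1) :
    f.eval x = (∑ j ∈ (range N).filter (fun j => j % 3 = 0), f.coeff j) +
      (∑ j ∈ (range N).filter (fun j => j % 3 = 1), f.coeff j) * x +
      (∑ j ∈ (range N).filter (fun j => j % 3 = 2), f.coeff j) * x ^ 2 := by
  rw [Polynomial.eval_eq_sum_range' hN]
  have key : ∀ j ∈ range N, f.coeff j * x ^ j =
      (if j % 3 = 0 then f.coeff j else 0) + (if j % 3 = 1 then f.coeff j else 0) * x +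
        (if j % 3 = 2 then f.coeff j else 0) * x ^ 2 := by
    intro j _
    rw [pow_eq_pow_mod_three hx]
    have hm : j % 3 < 3 := Nat.mod_lt _ (by norm_num)
    generalize j % 3 = m at hm ⊢
    interval_cases m <;> simp
  rw [sum_congr rfl key, sum_add_distrib, sum_add_distrib, ← sum_mul, ← sum_mul, ← sum_filter, ← sum_filter,
    ← sum_filter]

variable [CharP F 2]

/-- In characteristic `2`: `det(B + x·1) = χ_B(x)` (`= det(x·1 − B)`, Mathlib `Matrix.eval_charpoly`).
[cite: HeathBrown1994SelmerCongruentII, §2] -/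
theorem det_add_scalar_eq_eval_charpoly (B : Matrix n n F) (x : F) :
    (B + Matrix.scalar n x).det = B.charpoly.eval x := by
  have h1 : B + Matrix.scalar n x = Matrix.scalar n x - B := by
    ext i j
    rw [Matrix.add_apply, Matrix.sub_apply, CharTwo.sub_eq_add, add_comm]
  rw [h1, Matrix.eval_charpoly]

/-- `Φ₃(B) = B² + B + 1 = (B + ω)(B + ω²)` in characteristic `2`, for `ω² + ω + 1 = 0`.  (Brick `phi3_factor`.)
[cite: HeathBrown1994SelmerCongruentII, §2] -/
theorem phi3_factor (B : Matrix n n F) {ω : F} (hω : ω ^ 2 + ω + 1 = 0) :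
    B * B + B + 1 = (B + Matrix.scalar n ω) * (B + Matrix.scalar n (ω ^ 2)) := by
  have h3 : ω ^ 3 = 1 := by linear_combination (ω - 1) * hω
  have h12 : ω + ω ^ 2 = 1 := by
    have h : ω + ω ^ 2 = -1 := by linear_combination hω
    rw [h, CharTwo.neg_eq]
  have hc : Matrix.scalar n ω * B = B * Matrix.scalar n ω :=
    (Matrix.scalar_commute ω (fun r' => Commute.all ω r') B).eq
  symm
  calc (B + Matrix.scalar n ω) * (B + Matrix.scalar n (ω ^ 2))
      = B * B + B * (Matrix.scalar n ω + Matrix.scalar n (ω ^ 2)) +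
          Matrix.scalar n ω * Matrix.scalar n (ω ^ 2) := by
        rw [add_mul, mul_add, mul_add, hc, mul_add]
        abel
    _ = B * B + B + 1 := by
        rw [← map_add, h12, map_one, mul_one, ← map_mul, ← pow_succ', h3, map_one]

/-- **Memo #4 Thm 10.1 over any characteristic-`2` commutative ring containing a root `ω` of `X² + X + 1`:**
`det(B² + B + 1) = χ_B(ω)·χ_B(ω²) = c₀² + c₁² + c₂² + c₀c₁ + c₀c₂ + c₁c₂`, with `c_r = Σ_{j ≤ N, j ≡ r (3)} coeff_j χ_B`
(`N = card n`).  (Brick `det_phi3_eq_of_root`, with principal-minor sums replaced by charpoly coefficients.)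
[cite: HeathBrown1994SelmerCongruentII, §2] -/
theorem det_phi3_eq_of_root (B : Matrix n n F) {ω : F} (hω : ω ^ 2 + ω + 1 = 0) :
    (B * B + B + 1).det =
      (∑ j ∈ (range (Fintype.card n + 1)).filter (fun j => j % 3 = 0), B.charpoly.coeff j) ^ 2 +
      (∑ j ∈ (range (Fintype.card n + 1)).filter (fun j => j % 3 = 1), B.charpoly.coeff j) ^ 2 +
      (∑ j ∈ (range (Fintype.card n + 1)).filter (fun j => j % 3 = 2), B.charpoly.coeff j) ^ 2 +
      ((∑ j ∈ (range (Fintype.card n + 1)).filter (fun j => j % 3 = 0), B.charpoly.coeff j) *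
          (∑ j ∈ (range (Fintype.card n + 1)).filter (fun j => j % 3 = 1), B.charpoly.coeff j) +
        (∑ j ∈ (range (Fintype.card n + 1)).filter (fun j => j % 3 = 0), B.charpoly.coeff j) *
          (∑ j ∈ (range (Fintype.card n + 1)).filter (fun j => j % 3 = 2), B.charpoly.coeff j) +
        (∑ j ∈ (range (Fintype.card n + 1)).filter (fun j => j % 3 = 1), B.charpoly.coeff j) *
          (∑ j ∈ (range (Fintype.card n + 1)).filter (fun j => j % 3 = 2), B.charpoly.coeff j)) := by
  nontriviality F
  have h3 : ω ^ 3 = 1 := by linear_combination (ω - 1) * hω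
  have h3' : (ω ^ 2) ^ 3 = 1 := by rw [← pow_mul, mul_comm, pow_mul, h3, one_pow]
  have h12 : ω ^ 2 + ω = 1 := by
    have h : ω ^ 2 + ω = -1 := by linear_combination hω
    rw [h, CharTwo.neg_eq]
  have hN : B.charpoly.natDegree < Fintype.card n + 1 := by
    rw [Matrix.charpoly_natDegree_eq_dim]; exact Nat.lt_succ_self _
  rw [phi3_factor B hω, det_mul, det_add_scalar_eq_eval_charpoly, det_add_scalar_eq_eval_charpoly,
    eval_eq_sum_mod_three _ hN h3, eval_eq_sum_mod_three _ hN h3']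
  set a := ∑ j ∈ (range (Fintype.card n + 1)).filter (fun j => j % 3 = 0), B.charpoly.coeff j
  set b := ∑ j ∈ (range (Fintype.card n + 1)).filter (fun j => j % 3 = 1), B.charpoly.coeff j
  set c := ∑ j ∈ (range (Fintype.card n + 1)).filter (fun j => j % 3 = 2), B.charpoly.coeff j
  linear_combination (a * b + a * c + b * c) * h12 +
    (a * c * ω + b * c * (ω ^ 2 + ω) + b ^ 2 + c ^ 2 * (ω ^ 3 + 1)) * h3

end CharTwo

section FTwo

/-- **Memo #4 Thm 10.1 (norm form of `det Φ₃`), over `𝔽₂`:** `det Φ₃(B) = A₀ + A₁ + A₂ + A₀A₁ + A₀A₂ + A₁A₂`,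
`A_r = Σ_{j ≤ N, j ≡ r (3)} coeff_j χ_B` (`= Σ_{N − |S| ≡ r (3)} det B_S`).  Proof: base-change to
`𝔽₄ = 𝔽₂[X]/(X² + X + 1)` (`AdjoinRoot`), `det_phi3_eq_of_root`, `a² = a` in `𝔽₂`, injectivity.  (Brick `det_phi3_eq`.)
[cite: HeathBrown1994SelmerCongruentII, §2] -/
theorem det_phi3_eq (B : Matrix n n (ZMod 2)) :
    (phi3 B).det =
      (∑ j ∈ (range (Fintype.card n + 1)).filter (fun j => j % 3 = 0), B.charpoly.coeff j) +
      (∑ j ∈ (range (Fintype.card n + 1)).filter (fun j => j % 3 = 1), B.charpoly.coeff j) +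
      (∑ j ∈ (range (Fintype.card n + 1)).filter (fun j => j % 3 = 2), B.charpoly.coeff j) +
      ((∑ j ∈ (range (Fintype.card n + 1)).filter (fun j => j % 3 = 0), B.charpoly.coeff j) *
          (∑ j ∈ (range (Fintype.card n + 1)).filter (fun j => j % 3 = 1), B.charpoly.coeff j) +
        (∑ j ∈ (range (Fintype.card n + 1)).filter (fun j => j % 3 = 0), B.charpoly.coeff j) *
          (∑ j ∈ (range (Fintype.card n + 1)).filter (fun j => j % 3 = 2), B.charpoly.coeff j) +
        (∑ j ∈ (range (Fintype.card n + 1)).filter (fun j => j % 3 = 1), B.charpoly.coeff j) *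
          (∑ j ∈ (range (Fintype.card n + 1)).filter (fun j => j % 3 = 2), B.charpoly.coeff j)) := by
  -- pass to `𝔽₄ = 𝔽₂[X]/(X² + X + 1)`
  let f : (ZMod 2)[X] := X ^ 2 + X + 1
  have hf : f.degree ≠ 0 := by
    have h : f.degree = 2 := by
      show (X ^ 2 + X + 1 : (ZMod 2)[X]).degree = 2
      compute_degree!
    rw [h]; decide
  haveI : Nontrivial (AdjoinRoot f) := AdjoinRoot.nontrivial f hf
  let φ : ZMod 2 →+* AdjoinRoot f := AdjoinRoot.of f
  haveI : CharP (AdjoinRoot f) 2 := charP_of_injective_ringHom φ.injective 2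
  have hω : (AdjoinRoot.root f) ^ 2 + AdjoinRoot.root f + 1 = 0 := by
    have h := AdjoinRoot.eval₂_root f
    simpa [f, eval₂_add, eval₂_pow, eval₂_X, eval₂_one] using h
  have hsq : ∀ a : ZMod 2, φ a ^ 2 = φ a := fun a => by rw [← map_pow, ZMod.pow_card]
  apply φ.injective
  have key := det_phi3_eq_of_root (B.map φ) hω
  have hcoeff : ∀ j, (B.map φ).charpoly.coeff j = φ (B.charpoly.coeff j) := fun j => by
    rw [Matrix.charpoly_map, Polynomial.coeff_map]
  simp only [hcoeff, ← map_sum, hsq] at key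
  rw [phi3, RingHom.map_det, map_add, map_add, map_mul, map_one, RingHom.mapMatrix_apply, key]
  simp only [map_add, map_mul]

/-- `det Φ₃(B) = 1 ⟺ A₀, A₁, A₂ are NOT all equal` (the norm `N_{𝔽₄/𝔽₂}(a + bω) = a² + ab + b²` vanishes only at
`a = b = 0`, `a = A₀ + A₂`, `b = A₁ + A₂`).  (Brick `det_phi3_eq_one_iff`.) [cite: HeathBrown1994SelmerCongruentII, §2] -/
theorem det_phi3_eq_one_iff (B : Matrix n n (ZMod 2)) :
    (phi3 B).det = 1 ↔
      ¬ ((∑ j ∈ (range (Fintype.card n + 1)).filter (fun j => j % 3 = 0), B.charpoly.coeff j) =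
            (∑ j ∈ (range (Fintype.card n + 1)).filter (fun j => j % 3 = 1), B.charpoly.coeff j) ∧
          (∑ j ∈ (range (Fintype.card n + 1)).filter (fun j => j % 3 = 1), B.charpoly.coeff j) =
            (∑ j ∈ (range (Fintype.card n + 1)).filter (fun j => j % 3 = 2), B.charpoly.coeff j)) := by
  rw [det_phi3_eq]
  generalize (∑ j ∈ (range (Fintype.card n + 1)).filter (fun j => j % 3 = 0), B.charpoly.coeff j) = a
  generalize (∑ j ∈ (range (Fintype.card n + 1)).filter (fun j => j % 3 = 1), B.charpoly.coeff j) = b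
  generalize (∑ j ∈ (range (Fintype.card n + 1)).filter (fun j => j % 3 = 2), B.charpoly.coeff j) = c
  revert a b c
  decide

/-- `det Φ₃(B) = 0 ⟺ A₀ = A₁ = A₂`.  (Brick `det_phi3_eq_zero_iff`.) [cite: HeathBrown1994SelmerCongruentII, §2] -/
theorem det_phi3_eq_zero_iff (B : Matrix n n (ZMod 2)) :
    (phi3 B).det = 0 ↔
      ((∑ j ∈ (range (Fintype.card n + 1)).filter (fun j => j % 3 = 0), B.charpoly.coeff j) =
          (∑ j ∈ (range (Fintype.card n + 1)).filter (fun j => j % 3 = 1), B.charpoly.coeff j) ∧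
        (∑ j ∈ (range (Fintype.card n + 1)).filter (fun j => j % 3 = 1), B.charpoly.coeff j) =
          (∑ j ∈ (range (Fintype.card n + 1)).filter (fun j => j % 3 = 2), B.charpoly.coeff j)) := by
  rw [det_phi3_eq]
  generalize (∑ j ∈ (range (Fintype.card n + 1)).filter (fun j => j % 3 = 0), B.charpoly.coeff j) = a
  generalize (∑ j ∈ (range (Fintype.card n + 1)).filter (fun j => j % 3 = 1), B.charpoly.coeff j) = b
  generalize (∑ j ∈ (range (Fintype.card n + 1)).filter (fun j => j % 3 = 2), B.charpoly.coeff j) = c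
  revert a b c
  decide

/-- Over `𝔽₂` the coefficients of `χ_B` ARE the principal-minor sums of the pen's memo #4 §10 (no signs):
`coeff_{N−k} χ_B = Σ_{|s| = k} det B_{s,s}` (Mathlib `Matrix.charpoly_coeff_eq_sum_minors` with `(−1)^k = 1`), so the
sums `A_r` above are the `A_r = Σ_{N − |S| ≡ r (3)} det B_S` of the memo. [cite: HeathBrown1994SelmerCongruentII, §2] -/
theorem charpoly_coeff_eq_sum_minors_zmod2 (B : Matrix n n (ZMod 2)) {k : ℕ} (hk : k ≤ Fintype.card n) :
    B.charpoly.coeff (Fintype.card n - k) =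
      ∑ s ∈ (univ : Finset n).powersetCard k, (B.submatrix (Subtype.val : s → n) Subtype.val).det := by
  rw [Matrix.charpoly_coeff_eq_sum_minors B k hk]
  have h1 : ((-1 : ZMod 2)) ^ k = 1 := by
    rw [show (-1 : ZMod 2) = 1 by decide, one_pow]
  rw [h1, one_mul]

/-- The bottom coefficient is the full minor: `coeff_0 χ_B = det B` over `𝔽₂` (in general `(−1)^N det B`) — on the bordered
side `det B(Q₀,p₀)` is the «genus bit» of memo #4 Cor 10.3; and `χ_B` is monic (`coeff_N = a_0 = 1`).
[cite: HeathBrown1994SelmerCongruentII, §2] -/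
theorem charpoly_coeff_zero_eq_det (B : Matrix n n (ZMod 2)) :
    B.charpoly.coeff 0 = B.det ∧ B.charpoly.coeff (Fintype.card n) = 1 := by
  refine ⟨?_, ?_⟩
  · rw [Matrix.det_eq_sign_charpoly_coeff]
    have h1 : ((-1 : ZMod 2)) ^ Fintype.card n = 1 := by
      rw [show (-1 : ZMod 2) = 1 by decide, one_pow]
    rw [h1, one_mul]
  · have h := B.charpoly_monic
    rw [Polynomial.Monic, Polynomial.leadingCoeff, Matrix.charpoly_natDegree_eq_dim] at h
    exact h

end FTwo

section Line49Bridge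

/-- **The LINE 49 pair criterion in coefficient sums (memo #4 §10 ∘ Thm 10.1):** `LaplacianPairCriterion Q₀ p₀` holds iff
NEITHER for the Rédei–Laplacian `Ĝ(Q₀)` NOR for the bordered Laplacian `B(Q₀,p₀)` the three sums `A₀, A₁, A₂` of
characteristic-polynomial coefficients in the residue classes mod `3` coincide.  By the landed SEL corollary
`…TorsionCellSELGenericCriterion.selmerGenericPair_iff_laplacianPairCriterion` this is the Selmer-genericity of the genus pair.
[cite: HeathBrown1994SelmerCongruentII, §2] [cite: Kane2013SelmerTwists, §2] -/
theorem laplacianPairCriterion_iff_coeff_sums (Q₀ : Finset ℕ) (p₀ : ℕ) :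
    LaplacianPairCriterion Q₀ p₀ ↔
      ¬ ((∑ j ∈ (range (Fintype.card Q₀ + 1)).filter (fun j => j % 3 = 0), (redeiLaplacian Q₀).charpoly.coeff j) =
            (∑ j ∈ (range (Fintype.card Q₀ + 1)).filter (fun j => j % 3 = 1), (redeiLaplacian Q₀).charpoly.coeff j) ∧
          (∑ j ∈ (range (Fintype.card Q₀ + 1)).filter (fun j => j % 3 = 1), (redeiLaplacian Q₀).charpoly.coeff j) =
            (∑ j ∈ (range (Fintype.card Q₀ + 1)).filter (fun j => j % 3 = 2), (redeiLaplacian Q₀).charpoly.coeff j)) ∧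
      ¬ ((∑ j ∈ (range (Fintype.card Q₀ + 1)).filter (fun j => j % 3 = 0),
              (borderedLaplacian Q₀ p₀).charpoly.coeff j) =
            (∑ j ∈ (range (Fintype.card Q₀ + 1)).filter (fun j => j % 3 = 1),
              (borderedLaplacian Q₀ p₀).charpoly.coeff j) ∧
          (∑ j ∈ (range (Fintype.card Q₀ + 1)).filter (fun j => j % 3 = 1),
              (borderedLaplacian Q₀ p₀).charpoly.coeff j) =
            (∑ j ∈ (range (Fintype.card Q₀ + 1)).filter (fun j => j % 3 = 2),
              (borderedLaplacian Q₀ p₀).charpoly.coeff j)) := by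
  rw [LaplacianPairCriterion, det_phi3_eq_one_iff, det_phi3_eq_one_iff]

end Line49Bridge

end Summit.BirchSwinnertonDyer.BirchSwinnertonDyer.Theorems.GenusKolyvaginAtTwo.FullVertex.Phi3Norm
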